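import Summits.Parity.GeneralizedHardyLittlewood.Theorems.FordMaynardSieveConst01651SieveConst01651BuchstabCert
import HarnessLib

/-!
# Route `FordMaynardSieveConst01651`, target `SieveConst01651` (stmt-Parity-19185), stub `stub_certValuePos` (R2):
# kernel facts — the table's cell bounds fit in 48 bits

Def-free helper file.  The packed block tables of `…BuchstabCert` use base `2⁴⁸` digits; reading them back
(`…CertLookups.digit48_pack48`) needs every packed value `< 2⁴⁸`, which follows from every cell value being `< 2⁴⁸`
(`Φ∓ ≈ 3.4·2⁴⁰ < 2⁴²`).  Both facts are evaluated by the kernel (`decide +kernel`, ≈ 50 s each, standard axioms).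

References: folklore.
-/

namespace Summit.Parity.GeneralizedHardyLittlewood.FordMaynardSieveConst01651SieveConst01651

/-- Every `Φ⁻` cell value of `certCellsLo` is `< 2⁴⁸` (kernel evaluation). [folklore] -/
theorem certCellsLo_all_lt : (certCellsLo.all fun x => decide (x < 2 ^ 48)) = true := by decide +kernel

/-- Every `Φ⁺` cell value of `certCellsHi` is `< 2⁴⁸` (kernel evaluation). [folklore] -/
theorem certCellsHi_all_lt : (certCellsHi.all fun x => decide (x < 2 ^ 48)) = true := by decide +kernel

/-- Every `Φ⁻` cell value is `< 2⁴⁸`. [folklore] -/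
theorem certCellsLo_lt : ∀ x ∈ certCellsLo, x < 2 ^ 48 := by
  have h := certCellsLo_all_lt
  rw [List.all_eq_true] at h
  exact fun x hx => of_decide_eq_true (h x hx)

/-- Every `Φ⁺` cell value is `< 2⁴⁸`. [folklore] -/
theorem certCellsHi_lt : ∀ x ∈ certCellsHi, x < 2 ^ 48 := by
  have h := certCellsHi_all_lt
  rw [List.all_eq_true] at h
  exact fun x hx => of_decide_eq_true (h x hx)

end Summit.Parity.GeneralizedHardyLittlewood.FordMaynardSieveConst01651SieveConst01651
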